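import Mathlib
import Summits.NavierStokesRegularity.FluidComputer.MonotoneSchurStep
import Summits.NavierStokesRegularity.FluidComputer.APosterioriInverseBound

/-!
# The Loewner sentence `Hermitian H ⇒ H ≼ ‖H‖·1` in the spectral norm, and the certified-pivot step of the D2 recursion (cap g5, cell `ns-blowup`, 2026-08-26)

HONEST FRAMING (human ruling D-0035): nothing here is a claim about Navier–Stokes blow-up.
WHAT THIS IS NOT: not NS evidence. This file types the ONE sentence of the D2-3L-X0 inequality
chain (`cap/D2-CHAIN-MAP.md` step S4 (b′)) that was still paper-grade after p411713 / p418316: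

* `re_star_dotProduct_mulVec_le` — for ANY square matrix `M` over `𝕜 = ℝ, ℂ` and any vector `x`,
  `re (xᴴ M x) ≤ ‖M‖ · re (xᴴ x)` with `‖·‖` the `L²`-operator (spectral) norm
  (`Matrix.Norms.L2Operator`): Cauchy–Schwarz plus `‖M x‖ ≤ ‖M‖‖x‖`.
* `posSemidef_smul_one_sub_of_norm_le` — if `H` is Hermitian and `‖H‖ ≤ δ` then `δ·1 − H` is
  positive semidefinite, i.e. `H ≼ δ·1` in the Loewner order used by `MonotoneSchurStep`
  (`(P − L).PosSemidef`); `posSemidef_norm_smul_one_sub` is the case `δ = ‖H‖`, and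
  `posSemidef_smul_one_add_of_norm_le` the mirror `−δ·1 ≼ H`.
* `posSemidef_truePivot_sub_certifiedPivot` — the recursion step as the script `d2_cert.py` runs it:
  with `0 ≺ L ≼ P` (certified exact lower bound `L` of the previous TRUE pivot `P`), ANY matrix `X`
  (the float inverse of `L`) and any `δ ≥ ‖L⁻¹ − X‖`, the computed block
  `S := N − Herm(Cᴴ X C) − ‖C‖²δ·1` is a Loewner LOWER bound of the true next pivot
  `N − Cᴴ P⁻¹ C`. Proof: `Cᴴ P⁻¹ C ≼ Cᴴ L⁻¹ C` (`MonotoneSchurStep.posSemidef_conjTranspose_inv_sub`),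
  `Cᴴ L⁻¹ C = Herm(Cᴴ X C) + Herm(Cᴴ (L⁻¹ − X) C)` and
  `Herm(Cᴴ (L⁻¹ − X) C) ≼ ‖C‖²‖L⁻¹ − X‖·1 ≼ ‖C‖²δ·1`
  (`APosterioriInverseBound.Matrix.l2_opNorm_conjTranspose_mul_mul_le`, `…l2_opNorm_hermPart_le`
  and the Loewner sentence above).

With this, step S4 of the chain map is kernel except (c) Gershgorin on balls (the positivity test of
each exact `L_u` itself, which is ball arithmetic in the script).

Mathlib + the two sibling kernel files; no new definitions.
-/

namespace Summit.NavierStokesRegularity.FluidComputer.HermitianLoewnerNormBound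

open scoped Matrix.Norms.L2Operator InnerProductSpace ComplexOrder
open Matrix WithLp

section RCLike

variable {𝕜 : Type*} [RCLike 𝕜] {n : Type*} [Fintype n] [DecidableEq n]

omit [DecidableEq n] in
/-- The quadratic form `xᴴ x` is the squared Euclidean norm of `x`: `re (xᴴ x) = ‖x‖²`
(with `x` read in `EuclideanSpace 𝕜 n`). -/
theorem re_star_dotProduct_self (x : n → 𝕜) :
    RCLike.re (star x ⬝ᵥ x) = ‖toLp 2 x‖ ^ 2 := by
  have h : ⟪toLp 2 x, toLp 2 x⟫_𝕜 = star x ⬝ᵥ x := by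
    rw [EuclideanSpace.inner_toLp_toLp, dotProduct_comm]
  rw [← h, inner_self_eq_norm_sq (𝕜 := 𝕜)]

omit [DecidableEq n] in
/-- The quadratic form `xᴴ x` is real: `im (xᴴ x) = 0`. -/
theorem im_star_dotProduct_self (x : n → 𝕜) : RCLike.im (star x ⬝ᵥ x) = 0 := by
  have h : ⟪toLp 2 x, toLp 2 x⟫_𝕜 = star x ⬝ᵥ x := by
    rw [EuclideanSpace.inner_toLp_toLp, dotProduct_comm]
  rw [← h]
  exact inner_self_im _

omit [DecidableEq n] in
/-- The quadratic form of `M` is an inner product: `xᴴ (M x) = ⟪x, M x⟫` in `EuclideanSpace 𝕜 n`. -/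
theorem star_dotProduct_mulVec_eq_inner (M : Matrix n n 𝕜) (x : n → 𝕜) :
    star x ⬝ᵥ (M *ᵥ x) = ⟪toLp 2 x, toLp 2 (M *ᵥ x)⟫_𝕜 := by
  rw [EuclideanSpace.inner_toLp_toLp, dotProduct_comm]

/-- `‖M x‖ ≤ ‖M‖ · ‖x‖` for the spectral norm, vectors read in `EuclideanSpace 𝕜 n`. -/
theorem norm_toLp_mulVec_le (M : Matrix n n 𝕜) (x : n → 𝕜) :
    ‖toLp 2 (M *ᵥ x)‖ ≤ ‖M‖ * ‖toLp 2 x‖ := by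
  simpa using Matrix.l2_opNorm_mulVec M (toLp 2 x)

/-- **Rayleigh-quotient bound.** For any square matrix `M` and vector `x`:
`re (xᴴ M x) ≤ ‖M‖ · re (xᴴ x)` (spectral norm). -/
theorem re_star_dotProduct_mulVec_le (M : Matrix n n 𝕜) (x : n → 𝕜) :
    RCLike.re (star x ⬝ᵥ (M *ᵥ x)) ≤ ‖M‖ * RCLike.re (star x ⬝ᵥ x) := by
  rw [star_dotProduct_mulVec_eq_inner, re_star_dotProduct_self]
  calc RCLike.re ⟪toLp 2 x, toLp 2 (M *ᵥ x)⟫_𝕜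
      ≤ ‖⟪toLp 2 x, toLp 2 (M *ᵥ x)⟫_𝕜‖ := RCLike.re_le_norm _
    _ ≤ ‖toLp 2 x‖ * ‖toLp 2 (M *ᵥ x)‖ := norm_inner_le_norm _ _
    _ ≤ ‖toLp 2 x‖ * (‖M‖ * ‖toLp 2 x‖) := by
        gcongr; exact norm_toLp_mulVec_le M x
    _ = ‖M‖ * ‖toLp 2 x‖ ^ 2 := by ring

omit [Fintype n] in
/-- A real multiple of the identity is Hermitian. -/
theorem isHermitian_ofReal_smul_one (δ : ℝ) : ((δ : 𝕜) • (1 : Matrix n n 𝕜)).IsHermitian := by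
  unfold Matrix.IsHermitian
  rw [conjTranspose_smul, conjTranspose_one, RCLike.star_def, RCLike.conj_ofReal]

/-- **The Loewner sentence.** If `H` is Hermitian and `‖H‖ ≤ δ` (spectral norm) then
`δ·1 − H` is positive semidefinite, i.e. `H ≼ δ·1`. -/
theorem posSemidef_smul_one_sub_of_norm_le {H : Matrix n n 𝕜} (hH : H.IsHermitian) {δ : ℝ}
    (hδ : ‖H‖ ≤ δ) : ((δ : 𝕜) • (1 : Matrix n n 𝕜) - H).PosSemidef := by
  refine PosSemidef.of_dotProduct_mulVec_nonneg ((isHermitian_ofReal_smul_one δ).sub hH)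
    fun x => ?_
  have hq : star x ⬝ᵥ (((δ : 𝕜) • (1 : Matrix n n 𝕜) - H) *ᵥ x)
      = (δ : 𝕜) * (star x ⬝ᵥ x) - star x ⬝ᵥ (H *ᵥ x) := by
    rw [sub_mulVec, smul_mulVec, one_mulVec, dotProduct_sub, dotProduct_smul, smul_eq_mul]
  rw [hq, RCLike.nonneg_iff]
  constructor
  · rw [map_sub, RCLike.re_ofReal_mul, sub_nonneg]
    have h1 := re_star_dotProduct_mulVec_le H x
    have h0 : 0 ≤ RCLike.re (star x ⬝ᵥ x) := by rw [re_star_dotProduct_self]; positivity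
    calc RCLike.re (star x ⬝ᵥ (H *ᵥ x)) ≤ ‖H‖ * RCLike.re (star x ⬝ᵥ x) := h1
      _ ≤ δ * RCLike.re (star x ⬝ᵥ x) := mul_le_mul_of_nonneg_right hδ h0
  · rw [map_sub, RCLike.im_ofReal_mul, hH.im_star_dotProduct_mulVec_self,
      im_star_dotProduct_self, mul_zero, sub_zero]

/-- `H ≼ ‖H‖·1` for Hermitian `H` (spectral norm). -/
theorem posSemidef_norm_smul_one_sub {H : Matrix n n 𝕜} (hH : H.IsHermitian) :
    (((‖H‖ : ℝ) : 𝕜) • (1 : Matrix n n 𝕜) - H).PosSemidef :=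
  posSemidef_smul_one_sub_of_norm_le hH le_rfl

/-- The mirror sentence: `−δ·1 ≼ H`, i.e. `δ·1 + H` is positive semidefinite, for Hermitian `H`
with `‖H‖ ≤ δ`. -/
theorem posSemidef_smul_one_add_of_norm_le {H : Matrix n n 𝕜} (hH : H.IsHermitian) {δ : ℝ}
    (hδ : ‖H‖ ≤ δ) : ((δ : 𝕜) • (1 : Matrix n n 𝕜) + H).PosSemidef := by
  have hδ' : ‖-H‖ ≤ δ := by rwa [norm_neg]
  have h := posSemidef_smul_one_sub_of_norm_le (δ := δ) hH.neg hδ'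
  simpa using h

/-- Loewner transitivity in the form the recursion uses: if `E` is Hermitian with `‖E‖ ≤ δ` then
`A − E ≽ A − δ·1`, i.e. `(A − E) − (A − δ·1)` is positive semidefinite, for any `A`. -/
theorem posSemidef_sub_sub_sub_smul_one {A E : Matrix n n 𝕜} (hE : E.IsHermitian) {δ : ℝ}
    (hδ : ‖E‖ ≤ δ) : ((A - E) - (A - (δ : 𝕜) • (1 : Matrix n n 𝕜))).PosSemidef := by
  have h := posSemidef_smul_one_sub_of_norm_le hE hδ
  convert h using 1
  abel

end RCLike

section D2Step

variable {m k : Type*} [Fintype m] [DecidableEq m] [Fintype k] [DecidableEq k]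

omit [Fintype k] [DecidableEq k] in
/-- The Hermitian part `Herm(M) = (M + Mᴴ)/2` of a square complex matrix is Hermitian. -/
theorem isHermitian_hermPart (M : Matrix k k ℂ) : ((2:ℂ)⁻¹ • (M + Mᴴ)).IsHermitian := by
  unfold Matrix.IsHermitian
  rw [conjTranspose_smul, conjTranspose_add, conjTranspose_conjTranspose, add_comm]
  norm_num

omit [Fintype k] [DecidableEq k] in
/-- A Hermitian matrix equals its Hermitian part. -/
theorem hermPart_eq_self_of_isHermitian {M : Matrix k k ℂ} (hM : M.IsHermitian) :
    (2:ℂ)⁻¹ • (M + Mᴴ) = M := by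
  rw [hM.eq, ← two_smul ℂ M, smul_smul]
  norm_num

omit [Fintype k] [DecidableEq k] in
/-- `Herm` is additive: `Herm(M₁) + Herm(M₂) = Herm(M₁ + M₂)`. -/
theorem hermPart_add (M₁ M₂ : Matrix k k ℂ) :
    (2:ℂ)⁻¹ • (M₁ + M₁ᴴ) + (2:ℂ)⁻¹ • (M₂ + M₂ᴴ) = (2:ℂ)⁻¹ • ((M₁ + M₂) + (M₁ + M₂)ᴴ) := by
  rw [conjTranspose_add, ← smul_add]
  congr 1
  abel

/-- Norm of the Hermitian part of a congruence: `‖Herm(Cᴴ E C)‖ ≤ ‖C‖²‖E‖` (spectral norm). -/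
theorem norm_hermPart_conjTranspose_mul_mul_le (C : Matrix m k ℂ) (E : Matrix m m ℂ) :
    ‖(2:ℂ)⁻¹ • (Cᴴ * E * C + (Cᴴ * E * C)ᴴ)‖ ≤ ‖C‖ ^ 2 * ‖E‖ :=
  (APosterioriInverseBound.Matrix.l2_opNorm_hermPart_le _).trans
    (APosterioriInverseBound.Matrix.l2_opNorm_conjTranspose_mul_mul_le C E)

/-- **The certified-pivot step of the D2 recursion (S4 (b′) of `D2-CHAIN-MAP.md`).**
Let `0 ≺ L ≼ P` (`L` = the certified exact lower bound of the previous TRUE pivot `P`), let `X` be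
ANY `m × m` matrix (the float inverse of `L`) and `δ ≥ ‖L⁻¹ − X‖` (spectral norm; the script's
`delta`, e.g. from `APosterioriInverseBound.Units.norm_inv_sub_le`). Then for every coupling block
`C` and diagonal block `N` the COMPUTED block `S = N − Herm(Cᴴ X C) − ‖C‖²δ·1` is a Loewner lower
bound of the TRUE next pivot: `(N − Cᴴ P⁻¹ C) − S` is positive semidefinite. Hence a certified
`L' ≼ S`, `L' ≻ 0` at the next level is again below the true pivot, and
`MonotoneSchurStep.posDef_fromBlocks_of_pivot_lowerBound` iterates. -/
theorem posSemidef_truePivot_sub_certifiedPivot {L P : Matrix m m ℂ} (hL : L.PosDef)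
    (hPL : (P - L).PosSemidef) (X : Matrix m m ℂ) {δ : ℝ} (hδ : ‖L⁻¹ - X‖ ≤ δ)
    (C : Matrix m k ℂ) (N : Matrix k k ℂ) :
    Matrix.PosSemidef ((N - Cᴴ * P⁻¹ * C) -
      (N - (2:ℂ)⁻¹ • (Cᴴ * X * C + (Cᴴ * X * C)ᴴ) - ((‖C‖ ^ 2 * δ : ℝ) : ℂ) • (1 : Matrix k k ℂ))) := by
  -- the two positive semidefinite pieces
  have h1 : (Cᴴ * L⁻¹ * C - Cᴴ * P⁻¹ * C).PosSemidef :=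
    MonotoneSchurStep.posSemidef_conjTranspose_inv_sub hL hPL C
  set E : Matrix m m ℂ := L⁻¹ - X with hE
  have hEH : ((2:ℂ)⁻¹ • (Cᴴ * E * C + (Cᴴ * E * C)ᴴ)).IsHermitian := isHermitian_hermPart _
  have hEn : ‖(2:ℂ)⁻¹ • (Cᴴ * E * C + (Cᴴ * E * C)ᴴ)‖ ≤ ‖C‖ ^ 2 * δ :=
    (norm_hermPart_conjTranspose_mul_mul_le C E).trans (by gcongr)
  have h2 : ((((‖C‖ ^ 2 * δ : ℝ) : ℂ)) • (1 : Matrix k k ℂ)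
      - (2:ℂ)⁻¹ • (Cᴴ * E * C + (Cᴴ * E * C)ᴴ)).PosSemidef :=
    posSemidef_smul_one_sub_of_norm_le hEH hEn
  -- Cᴴ L⁻¹ C is Hermitian, hence equal to its Hermitian part, which splits along L⁻¹ = X + E
  have hLH : (Cᴴ * L⁻¹ * C).IsHermitian := isHermitian_conjTranspose_mul_mul C hL.isHermitian.inv
  have hsplit : Cᴴ * L⁻¹ * C
      = (2:ℂ)⁻¹ • (Cᴴ * X * C + (Cᴴ * X * C)ᴴ) + (2:ℂ)⁻¹ • (Cᴴ * E * C + (Cᴴ * E * C)ᴴ) := by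
    rw [hermPart_add, ← Matrix.add_mul, ← Matrix.mul_add, hE, add_sub_cancel,
      hermPart_eq_self_of_isHermitian hLH]
  have key : (N - Cᴴ * P⁻¹ * C) -
      (N - (2:ℂ)⁻¹ • (Cᴴ * X * C + (Cᴴ * X * C)ᴴ) - ((‖C‖ ^ 2 * δ : ℝ) : ℂ) • (1 : Matrix k k ℂ))
      = (Cᴴ * L⁻¹ * C - Cᴴ * P⁻¹ * C)
        + ((((‖C‖ ^ 2 * δ : ℝ) : ℂ)) • (1 : Matrix k k ℂ)
            - (2:ℂ)⁻¹ • (Cᴴ * E * C + (Cᴴ * E * C)ᴴ)) := by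
    rw [hsplit]; abel
  rw [key]
  exact h1.add h2

end D2Step

end Summit.NavierStokesRegularity.FluidComputer.HermitianLoewnerNormBound
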